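import Summits.MatrixMultiplication.OmegaCensus.STPP211Z2pow6DirectChunks

/-!
# (2,1,1)¹⁰ ⊄ (ℤ/2)⁶ — part S2 class 05, decisions 3/4: direct search over the hard class #17 of `reps29` (roots d = 10 (part))

Cell `pub-omega` (unit `pub-omega-stpp-1-g37`), topic `Summits/MatrixMultiplication/OmegaCensus`.
HONEST FRAMING (verbatim): lottery ticket; floor = certified bounds/negative ranges. Census STRUCTURE bookkeeping (B5, `T1((ℤ/2)⁶)`, Pb237);
nothing here is a bound on `ω`.

Class #17 of `reps29` in the translated form `C' = hc05 = [0, 1, 3, 5, 9, 15, 17, 22, 33, 38]` (`+ 1`, block of `c = 1` first; linear stabilizer of order 128,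
root representatives [2, 6, 10, 11, 18, 26, 58]; HOME `pub-omega-stpp-1-g36/code/hard_perd.json`). The kernel evaluates the direct engine
(`STPP211Z2pow6DirectEngine.rootD`, soundness `noNF_of_rootD`) in CHUNKS of the root node (`STPP211Z2pow6DirectChunks.rootDX`, ≤ 10⁵ search
calls each, exact counts from the seat's C mirror `godc.c`; this file: 549,394 calls) and assembles `rootD C' d = true` per root by
`rootD_of_chunks`. The class theorem follows in `STPP211Z2pow6Hard05Class` (symmetry transport, `STPP211Z2pow6DirectTransport`).

References: H. Cohn, R. Kleinberg, B. Szegedy, C. Umans, FOCS 2005 (arXiv:math/0511460), Def. 5.1.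
-/

namespace Summit.MatrixMultiplication.OmegaCensus

namespace T1CosetEng

/-- KERNEL: root `d = 10`, chunk 10 (codes `x = 25 … 25` of the branching label's lane; 68,262 search calls). -/
theorem hc05_d10_c10 : rootDX [0, 1, 3, 5, 9, 15, 17, 22, 33, 38] 10 33554432 = true := by decide +kernel

/-- KERNEL: root `d = 10`, chunk 11 (codes `x = 26 … 30` of the branching label's lane; 56,724 search calls). -/
theorem hc05_d10_c11 : rootDX [0, 1, 3, 5, 9, 15, 17, 22, 33, 38] 10 2080374784 = true := by decide +kernel

/-- KERNEL: root `d = 10`, chunk 12 (codes `x = 31 … 31` of the branching label's lane; 59,546 search calls). -/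
theorem hc05_d10_c12 : rootDX [0, 1, 3, 5, 9, 15, 17, 22, 33, 38] 10 2147483648 = true := by decide +kernel

/-- KERNEL: root `d = 10`, chunk 13 (codes `x = 32 … 35` of the branching label's lane; 80,738 search calls). -/
theorem hc05_d10_c13 : rootDX [0, 1, 3, 5, 9, 15, 17, 22, 33, 38] 10 64424509440 = true := by decide +kernel

/-- KERNEL: root `d = 10`, chunk 14 (codes `x = 36 … 40` of the branching label's lane; 87,137 search calls). -/
theorem hc05_d10_c14 : rootDX [0, 1, 3, 5, 9, 15, 17, 22, 33, 38] 10 2130303778816 = true := by decide +kernel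

/-- KERNEL: root `d = 10`, chunk 15 (codes `x = 41 … 48` of the branching label's lane; 82,682 search calls). -/
theorem hc05_d10_c15 : rootDX [0, 1, 3, 5, 9, 15, 17, 22, 33, 38] 10 560750930165760 = true := by decide +kernel

/-- KERNEL: root `d = 10`, chunk 16 (codes `x = 49 … 56` of the branching label's lane; 97,245 search calls). -/
theorem hc05_d10_c16 : rootDX [0, 1, 3, 5, 9, 15, 17, 22, 33, 38] 10 143552238122434560 = true := by decide +kernel

/-- KERNEL: root `d = 10`, chunk 17 (codes `x = 57 … 63` of the branching label's lane; 17,060 search calls). -/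
theorem hc05_d10_c17 : rootDX [0, 1, 3, 5, 9, 15, 17, 22, 33, 38] 10 18302628885633695744 = true := by decide +kernel

end T1CosetEng

end Summit.MatrixMultiplication.OmegaCensus
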